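import Literature.Geometry.DiscreteGeometry.KissingNumberFourUniqueness
import HarnessLib

/-!
# Five unit vectors with inner products in `{-1, 0, -1/2}` and barycentre `0` form a triangular bipyramid

Framing: lottery ticket; floor = certified bounds/negative ranges. Venture `PackingBounds`, cell
`pub-packcert`, energy family E3PT (pub-packcert-energy gen 11).

The combinatorial step shared by the rigidity theorems of the five-point three-point certificates
(Thomson `s = 1`, Riesz `s = 2`): if `C ⊂ S² ⊂ ℝ³` has five points, `Σ_{x∈C} x = 0`, and
`⟪x,y⟫ ∈ {-1, 0, -1/2}` for all distinct `x, y ∈ C`, then `C` is a triangular bipyramid: there is an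
antipodal pair `±p ∈ C`, the other three points are orthogonal to `p` and pairwise at inner product
`-1/2` (`Bipyramid5.rigid`). Proof: every Gram row sums to `0`; by the frame-potential bound
`|C|² ≤ 3·Σ⟪x,y⟫²` (tree: `d4u_frame_potential`) an antipodal pair exists (otherwise `Σ⟪x,y⟫² ≤ 15/2 < 25/3`);
the `±` symmetry forces orthogonality to the poles; the remaining `3 × 3` Gram block is forced by the row sums.
-/

noncomputable section

open Finset
open scoped RealInnerProductSpace

namespace Summit.Ventures.PackingBounds.Energy.Bipyramid5

open Literature.Geometry.DiscreteGeometry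

/-- **Triangular bipyramid from the Gram data.** Five unit vectors of `ℝ³` with barycentre `0` and all
inner products of distinct points in `{-1, 0, -1/2}` consist of an antipodal pair `±p` and three points
orthogonal to `p`, pairwise at inner product `-1/2`. -/
theorem rigid (C : Finset (EuclideanSpace ℝ (Fin 3))) (hC : ∀ x ∈ C, ‖x‖ = 1) (h5 : C.card = 5)
    (hsum0 : ∑ x ∈ C, x = 0)
    (hvals : ∀ x ∈ C, ∀ y ∈ C, x ≠ y → inner ℝ x y = -1 ∨ inner ℝ x y = 0 ∨ inner ℝ x y = -1 / 2) :
    ∃ p ∈ C, -p ∈ C ∧ (∀ z ∈ C, z ≠ p → z ≠ -p → inner ℝ z p = 0)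
      ∧ (∀ z ∈ C, ∀ w ∈ C, z ≠ p → z ≠ -p → w ≠ p → w ≠ -p → z ≠ w → inner ℝ z w = -1 / 2) := by
  classical
  have hcard : (C.card : ℝ) = 5 := by exact_mod_cast h5
  -- row sums
  have hrow : ∀ x ∈ C, ∑ y ∈ C.erase x, inner ℝ x y = -1 := by
    intro x hx
    have htot : ∑ y ∈ C, inner ℝ x y = 0 := by rw [← inner_sum, hsum0, inner_zero_right]
    have hself : inner ℝ x x = (1 : ℝ) := by rw [real_inner_self_eq_norm_sq, hC x hx]; norm_num
    have := Finset.add_sum_erase C (fun y => inner ℝ x y) hx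
    rw [htot, hself] at this
    linarith
  -- an antipodal pair exists, by the frame-potential bound
  have hfr := d4u_frame_potential (EuclideanSpace.basisFun (Fin 3) ℝ) C hC
  rw [Fintype.card_fin, hcard] at hfr
  have hanti : ∃ p ∈ C, ∃ y ∈ C, inner ℝ p y = -1 := by
    by_contra hna
    push Not at hna
    have hrow2 : ∀ x ∈ C, ∑ y ∈ C, inner ℝ x y ^ 2 ≤ 3 / 2 := by
      intro x hx
      have hself : inner ℝ x x = (1 : ℝ) := by rw [real_inner_self_eq_norm_sq, hC x hx]; norm_num
      have hoff : ∑ y ∈ C.erase x, inner ℝ x y ^ 2 ≤ ∑ y ∈ C.erase x, (-(1 / 2 : ℝ)) * inner ℝ x y := by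
        refine Finset.sum_le_sum fun y hy => ?_
        have hyC : y ∈ C := Finset.mem_of_mem_erase hy
        have hxy : x ≠ y := fun h => (Finset.ne_of_mem_erase hy) h.symm
        rcases hvals x hx y hyC hxy with h | h | h
        · exact absurd h (hna x hx y hyC)
        · rw [h]; norm_num
        · rw [h]; norm_num
      rw [← Finset.mul_sum, hrow x hx] at hoff
      have := Finset.add_sum_erase C (fun y => inner ℝ x y ^ 2) hx
      rw [hself] at this
      linarith
    have htot : ∑ x ∈ C, ∑ y ∈ C, inner ℝ x y ^ 2 ≤ 5 * (3 / 2) := by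
      calc ∑ x ∈ C, ∑ y ∈ C, inner ℝ x y ^ 2 ≤ ∑ x ∈ C, (3 / 2 : ℝ) := Finset.sum_le_sum hrow2
        _ = 5 * (3 / 2) := by rw [Finset.sum_const, nsmul_eq_mul, h5]; norm_num
    have h3 : ((3 : ℕ) : ℝ) = 3 := by norm_num
    rw [h3] at hfr
    linarith
  obtain ⟨p, hp, y0, hy0, hpy⟩ := hanti
  have hy0eq : y0 = -p := by
    have := (inner_eq_neg_one_iff_of_norm_eq_one (𝕜 := ℝ) (hC p hp) (hC y0 hy0)).1 hpy
    rw [this, neg_neg]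
  have hnp : -p ∈ C := hy0eq ▸ hy0
  have hp0 : p ≠ 0 := by
    intro h; have := hC p hp; rw [h, norm_zero] at this; norm_num at this
  have hpnp : p ≠ -p := fun h => hp0 (by
    have : (2 : ℝ) • p = 0 := by rw [two_smul]; nth_rewrite 2 [h]; exact add_neg_cancel p
    exact (smul_eq_zero.1 this).resolve_left two_ne_zero)
  have horth : ∀ z ∈ C, z ≠ p → z ≠ -p → inner ℝ z p = 0 := by
    intro z hz hzp hznp
    have h1 := hvals z hz p hp hzp
    have h2 := hvals z hz (-p) hnp hznp
    rw [inner_neg_right] at h2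
    rcases h1 with a | a | a <;> rcases h2 with b | b | b <;> linarith
  refine ⟨p, hp, hnp, horth, ?_⟩
  set R : Finset (EuclideanSpace ℝ (Fin 3)) := (C.erase p).erase (-p) with hR
  have hnpC : -p ∈ C.erase p := Finset.mem_erase.2 ⟨fun h => hpnp h.symm, hnp⟩
  have hRcard : R.card = 3 := by
    rw [hR, Finset.card_erase_of_mem hnpC, Finset.card_erase_of_mem hp, h5]
  have hmemR : ∀ z, z ∈ R ↔ z ∈ C ∧ z ≠ p ∧ z ≠ -p := by
    intro z; rw [hR, Finset.mem_erase, Finset.mem_erase]; tauto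
  have hsplit : ∀ z ∈ R, ∀ g : EuclideanSpace ℝ (Fin 3) → ℝ,
      ∑ y ∈ C, g y = g p + g (-p) + g z + ∑ y ∈ R.erase z, g y := by
    intro z hz g
    rw [← Finset.add_sum_erase C g hp, ← Finset.add_sum_erase (C.erase p) g hnpC, ← hR,
      ← Finset.add_sum_erase R g hz]
    ring
  -- no antipodal pair inside R
  have hnoanti : ∀ z ∈ R, ∀ w ∈ R, inner ℝ z w ≠ -1 := by
    intro z hz w hw hzw
    obtain ⟨hzC, hzp, hznp⟩ := (hmemR z).1 hz
    obtain ⟨hwC, hwp, hwnp⟩ := (hmemR w).1 hw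
    have hweq : w = -z := by
      have := (inner_eq_neg_one_iff_of_norm_eq_one (𝕜 := ℝ) (hC z hzC) (hC w hwC)).1 hzw
      rw [this, neg_neg]
    have hz0 : z ≠ 0 := by
      intro h; have := hC z hzC; rw [h, norm_zero] at this; norm_num at this
    have hzw' : z ≠ w := by
      rw [hweq]; intro h
      have : (2 : ℝ) • z = 0 := by rw [two_smul]; nth_rewrite 2 [h]; exact add_neg_cancel z
      exact hz0 ((smul_eq_zero.1 this).resolve_left two_ne_zero)
    have hwRz : w ∈ R.erase z := Finset.mem_erase.2 ⟨hzw'.symm, hw⟩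
    have hcard1 : ((R.erase z).erase w).card = 1 := by
      rw [Finset.card_erase_of_mem hwRz, Finset.card_erase_of_mem hz, hRcard]
    obtain ⟨t, ht⟩ := Finset.card_eq_one.1 hcard1
    have htmem : t ∈ (R.erase z).erase w := by rw [ht]; exact Finset.mem_singleton_self t
    have htRz : t ∈ R.erase z := Finset.mem_of_mem_erase htmem
    have htw : t ≠ w := Finset.ne_of_mem_erase htmem
    have htR : t ∈ R := Finset.mem_of_mem_erase htRz
    have htz : t ≠ z := Finset.ne_of_mem_erase htRz
    obtain ⟨htC, htp, htnp⟩ := (hmemR t).1 htR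
    have htz0 : inner ℝ t z = 0 := by
      have h1 := hvals t htC z hzC htz
      have h2 := hvals t htC w hwC htw
      rw [hweq, inner_neg_right] at h2
      rcases h1 with a | a | a <;> rcases h2 with b | b | b <;> linarith
    have htot : ∑ y ∈ C, inner ℝ t y = 0 := by rw [← inner_sum, hsum0, inner_zero_right]
    have hself : inner ℝ t t = (1 : ℝ) := by rw [real_inner_self_eq_norm_sq, hC t htC]; norm_num
    have hsp := hsplit z hz (fun y => inner ℝ t y)
    have hrest : ∑ y ∈ R.erase z, inner ℝ t y = inner ℝ t w + ∑ y ∈ (R.erase z).erase w, inner ℝ t y :=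
      (Finset.add_sum_erase (R.erase z) (fun y => inner ℝ t y) hwRz).symm
    rw [ht, Finset.sum_singleton] at hrest
    have htp0 : inner ℝ t p = 0 := horth t htC htp htnp
    have htnp0 : inner ℝ t (-p) = 0 := by rw [inner_neg_right, htp0, neg_zero]
    have htw0 : inner ℝ t w = 0 := by rw [hweq, inner_neg_right, htz0, neg_zero]
    rw [htot, hrest, htp0, htnp0, htz0, htw0, hself] at hsp
    norm_num at hsp
  intro z hzC w hwC hzp hznp hwp hwnp hzw
  have hz : z ∈ R := (hmemR z).2 ⟨hzC, hzp, hznp⟩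
  have hw : w ∈ R := (hmemR w).2 ⟨hwC, hwp, hwnp⟩
  have hwRz : w ∈ R.erase z := Finset.mem_erase.2 ⟨fun h => hzw h.symm, hw⟩
  have hcard1 : ((R.erase z).erase w).card = 1 := by
    rw [Finset.card_erase_of_mem hwRz, Finset.card_erase_of_mem hz, hRcard]
  obtain ⟨t, ht⟩ := Finset.card_eq_one.1 hcard1
  have htmem : t ∈ (R.erase z).erase w := by rw [ht]; exact Finset.mem_singleton_self t
  have htRz : t ∈ R.erase z := Finset.mem_of_mem_erase htmem
  have htR : t ∈ R := Finset.mem_of_mem_erase htRz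
  have htz : t ≠ z := Finset.ne_of_mem_erase htRz
  obtain ⟨htC, htp, htnp⟩ := (hmemR t).1 htR
  have htot : ∑ y ∈ C, inner ℝ z y = 0 := by rw [← inner_sum, hsum0, inner_zero_right]
  have hself : inner ℝ z z = (1 : ℝ) := by rw [real_inner_self_eq_norm_sq, hC z hzC]; norm_num
  have hsp := hsplit z hz (fun y => inner ℝ z y)
  have hrest : ∑ y ∈ R.erase z, inner ℝ z y = inner ℝ z w + ∑ y ∈ (R.erase z).erase w, inner ℝ z y :=
    (Finset.add_sum_erase (R.erase z) (fun y => inner ℝ z y) hwRz).symm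
  rw [ht, Finset.sum_singleton] at hrest
  have hzp0 : inner ℝ z p = 0 := horth z hzC hzp hznp
  have hznp0 : inner ℝ z (-p) = 0 := by rw [inner_neg_right, hzp0, neg_zero]
  rw [htot, hrest, hzp0, hznp0, hself] at hsp
  have h1 := hvals z hzC w hwC hzw
  have h2 := hvals z hzC t htC htz.symm
  have n1 := hnoanti z hz w hw
  have n2 := hnoanti z hz t htR
  rcases h1 with a | a | a
  · exact absurd a n1
  · rcases h2 with b | b | b
    · exact absurd b n2
    · linarith
    · linarith
  · exact a

end Summit.Ventures.PackingBounds.Energy.Bipyramid5
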